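import Mathlib
import HarnessLib
import Literature.Probability.MarkovChains.EffectiveResistance
import Literature.Probability.MarkovChains.HittingTimeTransitive

/-!
# Commute time: `E_π(τ_{ab}) = E_π(τ_{ba})` for reversible chains, the cycle identity (Lemma 10.12), Prop. 10.10, the Commute Time Identity `t_{a↔b} = c_G R(a ↔ b)` (Prop. 10.7) with Cor. 10.8, and `t_{a↔b} ≤ 2nm ≤ n³` (Prop. 10.16 (a)) — Levin–Peres–Wilmer §10.3

HONEST FRAMING: exact (Metropolis-corrected) sampling algorithms for lattice gauge theory; figures
of merit are autocorrelation/cost numbers at stated couplings and volumes; no continuum-physics claim.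

Source: D. A. Levin, Y. Peres (with E. L. Wilmer), *Markov Chains and Mixing Times*, 2nd ed.,
AMS 2017 [LevinPeres2017], §10.3 "Commute Time" (pp. 131–134): eqs. (10.9)–(10.11), Prop. 10.7
(10.14), Cor. 10.8 (10.15), eq. (10.16), Remark 10.9, Prop. 10.10 (10.18) with (10.19)–(10.21),
Remark 10.11, Lemma 10.12 (10.22), Prop. 10.16 (a).  Conventions of `RandomTargetLemma.lean` (`IsHittingTimeSolution P h`:
the first-step equations of `h(a,b) = E_a(τ_b)`, return-time identity (10.4), triangle inequality
(10.7)), `HittingTimeTransitive.lean` / `TransitiveChains.lean` (`IsTransitive`, eq. (2.15);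
`E_π(τ_w)` constant on a transitive chain), `NetworkRandomWalk.lean` (networks `c`, `networkKernel`,
`nodeConductance`, `totalConductance = c_G`, `networkLaw = π`) and `EffectiveResistance.lean`
(`IsVoltage`, `unitVoltage = W₁`, `currentFlow`, `flowDiv`, `effectiveResistance = R(a ↔ b)`,
eqs. (9.5), (9.11), (9.22)).  Everything is PROVED (0 named facts).

* `commuteTime h a b = E_a(τ_b) + E_b(τ_a)` — **eq. (10.10)** [cite: LevinPeres2017, §10.3 eq. (10.10)];
* **eq. (10.20)** `LevinPeres2017_eq_10_20`: for a REVERSIBLE chain `E_π(τ_a) + E_a(τ_b) = E_π(τ_b) +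
  E_b(τ_a)` ("so far, we have not used transitivity") — DECLARED DEVIATION: via the symmetric pairing
  `Σ_x π(x)g(x)[f − Pf](x)` under detailed balance instead of path reversal (1.31)
  [cite: LevinPeres2017, §10.3 eqs. (10.19)–(10.20)];
* **LEMMA 10.12** `LevinPeres2017_lemma_10_12` (cycle identity for reversible chains)
  [cite: LevinPeres2017, §10.3 Lemma 10.12];
* **REMARK 10.9** (walk on a transitive network is a transitive chain) and **PROPOSITION 10.10**
  `LevinPeres2017_prop_10_10` (`E_a(τ_b) = E_b(τ_a)` on a transitive connected network; chain form
  `LevinPeres2017_prop_10_10_chain` for symmetric transitive `P`) [cite: LevinPeres2017, §10.3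
  Remark 10.9, Prop. 10.10];
* **PROPOSITION 10.7 (Commute Time Identity)** `LevinPeres2017_prop_10_7`:
  `t_{a↔b} = c_G R(a ↔ b)` [cite: LevinPeres2017, §10.3 Prop. 10.7 eq. (10.14)] — DECLARED DEVIATION
  (no trajectory space in this tree): proved through the network potentials,
  `E_a(τ_b) = R(a ↔ b) Σ_x c(x) W₁(x)` (`hitting_eq_resistance_mul_sum`: pair the unit voltage `W₁`
  with the "Laplacian" `div I_{h_b} = c − c_G 1_b` of the hitting times — first-step equations + the
  return-time identity (10.4) — and `h_b` with `div I₁ = ‖I₁‖(1_a − 1_b)`, the pairing being symmetric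
  by (9.22)), its mirror image with `W₁^{(b,a)} = 1 − W₁` and `R(b ↔ a) = R(a ↔ b)`; the book's proof
  uses the Green function `G_{τ_b}(a,a) = c(a)R(a ↔ b)` (Lemma 9.6) and Lemma 10.5 / (10.13);
* **COROLLARY 10.8** `LevinPeres2017_cor_10_8`: `R(a ↔ c) ≤ R(a ↔ b) + R(b ↔ c)`, proof as printed
  (hitting-time triangle inequality + Prop. 10.7) [cite: LevinPeres2017, §10.3 Cor. 10.8 eq. (10.15)];
  **eq. (10.27)** `LevinPeres2017_eq_10_27`: on a transitive network `E_a(τ_b) = ½ c_G R(a ↔ b)`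
  [cite: LevinPeres2017, §10.6 eq. (10.27)].
* `edgeFlow`, **`R(x ↔ y) ≤ 1/c(x,y)`** (Thomson on the unit flow through one edge) and
  **`R(a ↔ b) ≤ ρ·ℓ`** along a walk of `ℓ` edges of resistance `≤ ρ` (Cor. 10.8 iterated): the
  "`R(a ↔ b) ≤ diam`" step [cite: LevinPeres2017, §10.3, proof of Prop. 10.16; §9.4 Thm 9.10 /
  Cor. 9.13]; `effectiveResistance_bridge` — a bridge `{x,y}` has `R(x ↔ y) = 1/c(x,y)` (Thomson +
  Nash-Williams with one cutset; the mechanism of Example 9.7: in a tree `R(a ↔ z)` = path length)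
  [cite: LevinPeres2017, §9.4 Example 9.7];
* **PROPOSITION 10.16 (a)** `LevinPeres2017_prop_10_16_a` / `…_a'`: for simple random walk on a
  connected simple graph with `n ≥ 2` vertices and `m` edges (`c_G = 2m`, `totalConductance_adjMatrix`;
  Mathlib `SimpleGraph`, `Walk.bypass`, `IsPath.length_lt`, `card_edgeFinset_le_card_choose_two`),
  `t_{a↔b} ≤ 2nm` and `t_{a↔b} ≤ n³` [cite: LevinPeres2017, §10.3 Prop. 10.16 (a)].  NOT CLAIMED:
  Prop. 10.16 (b) (`d`-regular graphs, `diam ≤ 3n/d`).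

Context (cell pub-lqcd): commute / hitting times of reversible samplers between configurations (e.g.
topological sectors) are effective resistances of the move network times its total weight; Prop. 10.7
is the identity that turns autocorrelation questions into network (Thomson / Rayleigh) estimates.
-/

namespace Literature.Probability.MarkovChains

open Finset Matrix

variable {X : Type*} [Fintype X] [DecidableEq X]

omit [Fintype X] [DecidableEq X] in
/-- **Eq. (10.10) and the note after it**: the COMMUTE TIME `t_{a↔b} = E_a(τ_{a,b}) = E_a(τ_b) + E_b(τ_a)`,
on the matrix `h(a,b) = E_a(τ_b)` of expected hitting times (`IsHittingTimeSolution`).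
[cite: LevinPeres2017, §10.3 eqs. (10.9)–(10.10) ("Note that `t_{a↔b} = E_a(τ_b) + E_b(τ_a)`")] -/
def commuteTime (h : X → X → ℝ) (a b : X) : ℝ := h a b + h b a

omit [Fintype X] [DecidableEq X] in
/-- `t_{a↔b}` unfolded. [cite: LevinPeres2017, §10.3 eq. (10.10)] -/
theorem commuteTime_def (h : X → X → ℝ) (a b : X) : commuteTime h a b = h a b + h b a := rfl

omit [Fintype X] [DecidableEq X] in
/-- `t_{a↔b} = t_{b↔a}`. [cite: LevinPeres2017, §10.3 eq. (10.10)] -/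
theorem commuteTime_comm (h : X → X → ℝ) (a b : X) : commuteTime h a b = commuteTime h b a := by
  rw [commuteTime_def, commuteTime_def, add_comm]

/-! ## Reversible chains: `E_π(τ_{ab}) = E_π(τ_{ba})` (10.20), the cycle identity (Lemma 10.12), Prop. 10.10 -/

section Reversible

variable {P : Matrix X X ℝ} {π : X → ℝ} {h : X → X → ℝ}

omit [DecidableEq X] in
/-- Under detailed balance the pairing `(f, g) ↦ Σ_x π(x) g(x) [f(x) − (Pf)(x)]` is SYMMETRIC (it equals
`½ Σ_x Σ_y π(x)P(x,y)[f(x) − f(y)][g(x) − g(y)]`). [cite: LevinPeres2017, §10.3, proof of Prop. 10.10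
(the time-reversal identity (1.31) behind eq. (10.19)–(10.20))] -/
theorem DetailedBalance.sum_mul_sub_comm (hDB : DetailedBalance π P) (f g : X → ℝ) :
    ∑ x, π x * g x * (f x - ∑ y, P x y * f y) = ∑ x, π x * f x * (g x - ∑ y, P x y * g y) := by
  have hD : ∑ x, ∑ y, π x * P x y * (g x * f y) = ∑ x, ∑ y, π x * P x y * (f x * g y) := by
    rw [sum_comm]
    exact sum_congr rfl fun x _ => sum_congr rfl fun y _ => by rw [hDB y x]; ring
  have e1 : ∀ x, π x * g x * (f x - ∑ y, P x y * f y) =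
      π x * g x * f x - ∑ y, π x * P x y * (g x * f y) := fun x => by
    rw [mul_sub, mul_sum]
    exact congrArg _ (sum_congr rfl fun y _ => by ring)
  have e2 : ∀ x, π x * f x * (g x - ∑ y, P x y * g y) =
      π x * g x * f x - ∑ y, π x * P x y * (f x * g y) := fun x => by
    rw [mul_sub, mul_sum]
    exact congrArg₂ _ (by ring) (sum_congr rfl fun y _ => by ring)
  simp_rw [e1, e2]
  rw [sum_sub_distrib, sum_sub_distrib, hD]

/-- For the hitting times of `b`: `Σ_x π(x) g(x) [h_b(x) − (P h_b)(x)] = Σ_x π(x) g(x) − g(b)` — the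
first-step equations give `h_b − P h_b = 1` off `b`, and the return-time identity (10.4)
`π(b)[1 + (P h_b)(b)] = 1` handles `x = b`. [cite: LevinPeres2017, §10.2 eqs. (10.3)–(10.4)] -/
theorem IsHittingTimeSolution.sum_mul_sub (hπ : IsStationary π P)
    (hπ1 : ∑ x, π x = 1) (hh : IsHittingTimeSolution P h) (g : X → ℝ) (b : X) :
    ∑ x, π x * g x * (h x b - ∑ y, P x y * h y b) = ∑ x, π x * g x - g b := by
  have hret := returnTime_identity hπ hπ1 hh b
  have hterm : ∀ x, π x * g x * (h x b - ∑ y, P x y * h y b) =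
      π x * g x - if x = b then π b * (1 + ∑ y, P b y * h y b) * g b else 0 := by
    intro x
    by_cases hx : x = b
    · subst hx
      rw [if_pos rfl, hh.diag]
      ring
    · rw [if_neg hx, hh.off_diag hx]
      ring
  simp_rw [hterm]
  rw [sum_sub_distrib, sum_ite_eq' univ b, if_pos (mem_univ b), hret, one_mul]

/-- **Eq. (10.20): `E_π(τ_{ab}) = E_π(τ_{ba})` for a REVERSIBLE chain** — in hitting-time form
`Σ_x π(x)E_x(τ_a) + E_a(τ_b) = Σ_x π(x)E_x(τ_b) + E_b(τ_a)` ("So far, we have not used transitivity").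
[cite: LevinPeres2017, §10.3, proof of Prop. 10.10, eqs. (10.19)–(10.20)]  DECLARED DEVIATION: the
book reverses trajectories under `P_π` (identity (1.31)); here the symmetric pairing
`DetailedBalance.sum_mul_sub_comm` is evaluated on `(h_a, h_b)` both ways. -/
theorem LevinPeres2017_eq_10_20 (hP : IsRowStochastic P) (hDB : DetailedBalance π P)
    (hπ1 : ∑ x, π x = 1) (hh : IsHittingTimeSolution P h) (a b : X) :
    ∑ x, π x * h x a + h a b = ∑ x, π x * h x b + h b a := by
  have hπ : IsStationary π P := hDB.isStationary hP.2
  have h1 := hh.sum_mul_sub hπ hπ1 (fun x => h x a) b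
  have h2 := hh.sum_mul_sub hπ hπ1 (fun x => h x b) a
  have hs := hDB.sum_mul_sub_comm (fun x => h x b) (fun x => h x a)
  rw [h1, h2] at hs
  linarith

/-- **LEMMA 10.12 (cycle identity)**: for any three states of a reversible chain,
`E_a(τ_b) + E_b(τ_c) + E_c(τ_a) = E_a(τ_c) + E_c(τ_b) + E_b(τ_a)`. [cite: LevinPeres2017, §10.3
Lemma 10.12, eq. (10.22)]  Proof: by (10.20) `E_a(τ_b) − E_b(τ_a) = Φ(b) − Φ(a)` with
`Φ(w) = E_π(τ_w)`, and the three differences telescope (the book: "proved in the same manner as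
(10.20)"). -/
theorem LevinPeres2017_lemma_10_12 (hP : IsRowStochastic P) (hDB : DetailedBalance π P)
    (hπ1 : ∑ x, π x = 1) (hh : IsHittingTimeSolution P h) (a b c : X) :
    h a b + h b c + h c a = h a c + h c b + h b a := by
  have h1 := LevinPeres2017_eq_10_20 hP hDB hπ1 hh a b
  have h2 := LevinPeres2017_eq_10_20 hP hDB hπ1 hh b c
  have h3 := LevinPeres2017_eq_10_20 hP hDB hπ1 hh c a
  linarith

/-- **PROPOSITION 10.10 (chain form): for a reversible TRANSITIVE chain `E_a(τ_b) = E_b(τ_a)`** — a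
transitive chain (eq. (2.15)) which is reversible with respect to its (uniform, Prop. 2.16) stationary
law, i.e. has a symmetric transition matrix.  Proof as printed: (10.20) minus (10.21)
`E_π(τ_a) = E_π(τ_b)` (`stationaryHitting_eq_of_isTransitive`). [cite: LevinPeres2017, §10.3
Prop. 10.10, eqs. (10.18), (10.20)–(10.21); Remark 10.11 (reversibility is essential)] -/
theorem LevinPeres2017_prop_10_10_chain (hT : IsTransitive P) (hP : IsRowStochastic P)
    (hirr : IsIrreducible P) (hsymm : ∀ x y, P x y = P y x) (hh : IsHittingTimeSolution P h)
    (a b : X) : h a b = h b a := by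
  haveI : Nonempty X := ⟨a⟩
  have hcard : (Fintype.card X : ℝ) ≠ 0 := Nat.cast_ne_zero.2 Fintype.card_ne_zero
  set u : X → ℝ := fun _ => (Fintype.card X : ℝ)⁻¹ with hu
  have hDB : DetailedBalance u P := fun x y => by simp only [hu]; rw [hsymm x y]
  have hu1 : ∑ x, u x = 1 := by
    simp only [hu, sum_const, card_univ, nsmul_eq_mul]
    exact mul_inv_cancel₀ hcard
  have h20 := LevinPeres2017_eq_10_20 hP hDB hu1 hh a b
  have h21 := stationaryHitting_eq_of_isTransitive hT hP hirr (π := u) (fun _ => rfl) hh a b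
  linarith

end Reversible

/-! ## Networks: Remark 10.9 and Proposition 10.10 -/

section NetworkTransitive

variable {c : Matrix X X ℝ} {h : X → X → ℝ}

omit [DecidableEq X] in
/-- A network automorphism preserves `c(x)`: `c(ψ x) = c(x)`. [cite: LevinPeres2017, §10.3
eq. (10.16)] -/
theorem nodeConductance_equiv (ψ : X ≃ X) (hψ : ∀ u v, c (ψ u) (ψ v) = c u v) (x : X) :
    nodeConductance c (ψ x) = nodeConductance c x := by
  rw [nodeConductance_def, nodeConductance_def]
  calc ∑ y, c (ψ x) y = ∑ y, c (ψ x) (ψ y) := (Equiv.sum_comp ψ fun y => c (ψ x) y).symm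
    _ = ∑ y, c x y := sum_congr rfl fun y _ => hψ x y

omit [DecidableEq X] in
/-- **REMARK 10.9: the random walk on a transitive network is a transitive Markov chain** (a network
automorphism `ψ` of (10.16) satisfies `P(ψ z, ψ w) = P(z,w)`, eq. (2.15)). [cite: LevinPeres2017,
§10.3 Remark 10.9 with eq. (10.16) and §2.6.2 eq. (2.15)] -/
theorem LevinPeres2017_remark_10_9
    (hT : ∀ x y : X, ∃ ψ : X ≃ X, ψ x = y ∧ ∀ u v, c (ψ u) (ψ v) = c u v) :
    IsTransitive (networkKernel c) := by
  intro x y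
  obtain ⟨ψ, hψx, hψ⟩ := hT x y
  refine ⟨ψ, hψx, fun z w => ?_⟩
  rw [networkKernel_apply, networkKernel_apply, hψ z w, nodeConductance_equiv ψ hψ z]

omit [DecidableEq X] in
/-- "On a transitive network, the stationary distribution `π` is uniform": `c(x) = c(y)` for all
`x, y`, hence the walk has a symmetric transition matrix `P(x,y) = c(x,y)/c(x) = P(y,x)`.
[cite: LevinPeres2017, §10.3 (sentence after eq. (10.16))] -/
theorem networkKernel_symm_of_transitive (hc : IsConductance c)
    (hT : ∀ x y : X, ∃ ψ : X ≃ X, ψ x = y ∧ ∀ u v, c (ψ u) (ψ v) = c u v) (x y : X) :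
    networkKernel c x y = networkKernel c y x := by
  obtain ⟨ψ, hψx, hψ⟩ := hT x y
  have hcx : nodeConductance c x = nodeConductance c y := by
    rw [← hψx, nodeConductance_equiv ψ hψ x]
  rw [networkKernel_apply, networkKernel_apply, hc.symm y x, hcx]

/-- **PROPOSITION 10.10: for the random walk on a transitive connected network, `E_a(τ_b) = E_b(τ_a)`
for all nodes `a, b`.** [cite: LevinPeres2017, §10.3 Prop. 10.10, eq. (10.18)] -/
theorem LevinPeres2017_prop_10_10 (hc : IsConductance c) (hirr : IsIrreducible (networkKernel c))
    (hT : ∀ x y : X, ∃ ψ : X ≃ X, ψ x = y ∧ ∀ u v, c (ψ u) (ψ v) = c u v)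
    (hh : IsHittingTimeSolution (networkKernel c) h) (a b : X) : h a b = h b a :=
  LevinPeres2017_prop_10_10_chain (LevinPeres2017_remark_10_9 hT) (networkKernel_isRowStochastic hc)
    hirr (networkKernel_symm_of_transitive hc hT) hh a b

end NetworkTransitive

/-! ## Proposition 10.7 (Commute Time Identity) `t_{a↔b} = c_G R(a ↔ b)` and Corollary 10.8 -/

section CommuteTimeIdentity

variable {c : Matrix X X ℝ} {a b : X} {h : X → X → ℝ}

omit [DecidableEq X] in
/-- Voltages for `(a, z)` and for `(z, a)` are the same functions (harmonic off `{a, z}`).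
[cite: LevinPeres2017, §9.3 (definition of voltage)] -/
theorem IsVoltage.swap {z : X} {W : X → ℝ} (hW : IsVoltage c a z W) : IsVoltage c z a W :=
  fun x hxz hxa => hW x hxa hxz

omit [DecidableEq X] in
/-- The network pairing `(f, g) ↦ Σ_x g(x) div I_f(x) = ½ Σ_x Σ_y c(x,y)[f(x) − f(y)][g(x) − g(y)]` is
symmetric in `f` and `g` (eq. (9.22) applied to the current flow `I_f`). [cite: LevinPeres2017, §9.4
eq. (9.22)] -/
theorem sum_mul_flowDiv_currentFlow_comm (hc : IsConductance c) (f g : X → ℝ) :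
    ∑ x, g x * flowDiv (currentFlow c f) x = ∑ x, f x * flowDiv (currentFlow c g) x := by
  have h1 := LevinPeres2017_eq_9_22 (isFlow_currentFlow hc.symm f).1 g
  have h2 := LevinPeres2017_eq_9_22 (isFlow_currentFlow hc.symm g).1 f
  have h3 : ∑ x, ∑ y, (g x - g y) * currentFlow c f x y = ∑ x, ∑ y, (f x - f y) * currentFlow c g x y :=
    sum_congr rfl fun x _ => sum_congr rfl fun y _ => by rw [currentFlow_apply, currentFlow_apply]; ring
  linarith

/-- The "Laplacian" of the hitting times of `b` on a network: `div I_{h_b}(x) = c(x)[h_b(x) − (Ph_b)(x)]`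
is `c(x)` for `x ≠ b` (first-step equation) and `c(b) − c_G` at `b` (return-time identity (10.4) with
`π(b) = c(b)/c_G`); paired with any `g`: `Σ_x g(x) div I_{h_b}(x) = Σ_x c(x) g(x) − c_G g(b)`.
[cite: LevinPeres2017, §10.2 eqs. (10.3)–(10.4) with §9.1 (`π(x) = c(x)/c_G`)] -/
theorem sum_mul_flowDiv_currentFlow_hitting (hc : IsConductance c)
    (hh : IsHittingTimeSolution (networkKernel c) h) (g : X → ℝ) (b : X) :
    ∑ x, g x * flowDiv (currentFlow c fun x => h x b) x =
      ∑ x, nodeConductance c x * g x - totalConductance c * g b := by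
  haveI : Nonempty X := ⟨b⟩
  have hret := IsHittingTimeSolution.returnTime_identity (networkLaw_isStationary hc)
    (sum_networkLaw hc) hh b
  rw [networkLaw_apply] at hret
  have hcG := hc.totalConductance_pos.ne'
  -- `c(b) Σ_y P(b,y) h(y,b) = c_G − c(b)`
  have hb : nodeConductance c b * ∑ y, networkKernel c b y * h y b =
      totalConductance c - nodeConductance c b := by
    field_simp at hret
    linarith
  have hterm : ∀ x, g x * flowDiv (currentFlow c fun x => h x b) x =
      nodeConductance c x * g x - if x = b then totalConductance c * g b else 0 := by
    intro x
    rw [flowDiv_currentFlow hc]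
    by_cases hx : x = b
    · subst hx
      rw [if_pos rfl, hh.diag, zero_sub, mul_neg, hb]
      ring
    · rw [if_neg hx, hh.off_diag hx]
      ring
  simp_rw [hterm]
  rw [sum_sub_distrib, sum_ite_eq' univ b, if_pos (mem_univ b)]

/-- **`E_a(τ_b) = R(a ↔ b) · Σ_x c(x) W₁(x)`**, `W₁` the unit voltage (`W₁(a) = 1`, `W₁(b) = 0`): pair
`W₁` with `div I_{h_b}` (previous lemma: `Σ_x c(x)W₁(x)`, as `W₁(b) = 0`) and, symmetrically, `h_b`
with `div I₁ = ‖I₁‖(1_a − 1_b)` (node law: `‖I₁‖ E_a(τ_b)`), then use `R(a ↔ b) = 1/‖I₁‖`.  This is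
the network-potential route to Prop. 10.7 (DECLARED DEVIATION from the book's Green-function proof
via Lemma 9.6 / Lemma 10.5 / eq. (10.13), which needs the trajectory space). [cite: LevinPeres2017,
§10.3 Prop. 10.7 (proof ingredients: §9.4 eq. (9.11), §10.2 eqs. (10.3)–(10.4))] -/
theorem hitting_eq_resistance_mul_sum (hc : IsConductance c) (hirr : IsIrreducible (networkKernel c))
    (hab : a ≠ b) (hh : IsHittingTimeSolution (networkKernel c) h) :
    h a b = effectiveResistance c a b * ∑ x, nodeConductance c x * unitVoltage c a b x := by
  obtain ⟨hV, hVa, hVb⟩ := unitVoltage_spec hc hirr hab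
  have hpos := flowDiv_currentFlow_unitVoltage_pos hc hirr hab
  -- pairing of `W₁` with the hitting-time Laplacian
  have e1 := sum_mul_flowDiv_currentFlow_hitting hc hh (unitVoltage c a b) b
  rw [hVb, mul_zero, sub_zero] at e1
  -- pairing of `h_b` with `div I₁` (node law off `{a,b}`, `h(b,b) = 0`)
  have e2 : ∑ x, h x b * flowDiv (currentFlow c (unitVoltage c a b)) x =
      h a b * flowDiv (currentFlow c (unitVoltage c a b)) a := by
    rw [sum_eq_add_of_forall_ne hab fun x hxa hxb => by
      rw [hV.flowDiv_currentFlow_eq_zero hc hxa hxb, mul_zero], hh.diag, zero_mul, add_zero]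
  have hs := sum_mul_flowDiv_currentFlow_comm hc (fun x => h x b) (unitVoltage c a b)
  rw [e1, e2] at hs
  rw [effectiveResistance, hs]
  field_simp

/-- The unit voltage for `(b, a)` is `1 − W₁` (uniqueness, Prop. 9.1). [cite: LevinPeres2017, §9.3
("a voltage is completely determined by its boundary values")] -/
theorem unitVoltage_swap (hc : IsConductance c) (hirr : IsIrreducible (networkKernel c)) (hab : a ≠ b) :
    unitVoltage c b a = fun x => 1 - unitVoltage c a b x := by
  obtain ⟨hV, hVa, hVb⟩ := unitVoltage_spec hc hirr hab
  obtain ⟨hV', hV'b, hV'a⟩ := unitVoltage_spec hc hirr hab.symm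
  have h1 : IsVoltage c b a (fun x => 1 - unitVoltage c a b x) := by
    have := (hV.affine hc 1 (-1)).swap
    simpa [sub_eq_add_neg] using this
  refine hV'.unique hc hirr h1 ?_ ?_
  · simp only [hV'b, hVb, sub_zero]
  · simp only [hV'a, hVa, sub_self]

/-- **`R(a ↔ b) = R(b ↔ a)`** (apply (9.11) for the pair `(b, a)` to the voltage `W₁` of `(a, b)`:
`W₁(b) − W₁(a) = −1 = R(b ↔ a)·div I₁(b) = −R(b ↔ a)‖I₁‖`). [cite: LevinPeres2017, §9.4 eq. (9.11)] -/
theorem effectiveResistance_comm (hc : IsConductance c) (hirr : IsIrreducible (networkKernel c))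
    (hab : a ≠ b) : effectiveResistance c b a = effectiveResistance c a b := by
  obtain ⟨hV, hVa, hVb⟩ := unitVoltage_spec hc hirr hab
  have hpos := flowDiv_currentFlow_unitVoltage_pos hc hirr hab
  have h11 := LevinPeres2017_eq_9_11 hc hirr hab.symm hV.swap
  -- `div I₁(b) = −div I₁(a)`
  have hsink : flowDiv (currentFlow c (unitVoltage c a b)) b =
      -flowDiv (currentFlow c (unitVoltage c a b)) a := by
    have h0 := LevinPeres2017_eq_9_5 (isFlow_currentFlow hc.symm (unitVoltage c a b)).1
    rw [sum_eq_add_of_forall_ne hab fun x hxa hxb => hV.flowDiv_currentFlow_eq_zero hc hxa hxb] at h0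
    linarith
  rw [hVa, hVb, hsink] at h11
  have h1 : effectiveResistance c b a * flowDiv (currentFlow c (unitVoltage c a b)) a = 1 := by
    linarith
  rw [show effectiveResistance c a b = 1 / flowDiv (currentFlow c (unitVoltage c a b)) a from rfl,
    eq_div_iff hpos.ne']
  exact h1

omit [DecidableEq X] in
/-- `R(a ↔ a) = 0` (the junk value of the definition agrees with the natural convention).
[cite: LevinPeres2017, §9.4 eq. (9.11)] -/
theorem effectiveResistance_self (c : Matrix X X ℝ) (a : X) : effectiveResistance c a a = 0 := by
  have h0 : unitVoltage c a a = 0 := by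
    rw [unitVoltage, dif_neg]
    rintro ⟨W, -, h1, h0⟩
    rw [h0] at h1
    exact zero_ne_one h1
  rw [effectiveResistance, h0, flowDiv_def]
  simp [currentFlow_apply]

/-- **PROPOSITION 10.7 (COMMUTE TIME IDENTITY): `t_{a↔b} = E_a(τ_b) + E_b(τ_a) = c_G R(a ↔ b)` for
the random walk on a network** (`c_G = Σ_x c(x)`). [cite: LevinPeres2017, §10.3 Prop. 10.7,
eq. (10.14)]  DECLARED DEVIATION (proof route): `E_a(τ_b) = R(a ↔ b)Σ_x c(x)W₁(x)` and
`E_b(τ_a) = R(a ↔ b)Σ_x c(x)[1 − W₁(x)]` (`hitting_eq_resistance_mul_sum` for both orientations,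
`W₁^{(b,a)} = 1 − W₁`, `R(b ↔ a) = R(a ↔ b)`) are added; the book's proof goes through the Green
function `G_{τ_b}(a,a) = c(a)R(a ↔ b)` (Lemma 9.6) and Lemma 10.5 / eq. (10.13) on the path space. -/
theorem LevinPeres2017_prop_10_7 (hc : IsConductance c) (hirr : IsIrreducible (networkKernel c))
    (hh : IsHittingTimeSolution (networkKernel c) h) (a b : X) :
    commuteTime h a b = totalConductance c * effectiveResistance c a b := by
  rw [commuteTime_def]
  rcases eq_or_ne a b with rfl | hab
  · rw [hh.diag, effectiveResistance_self, add_zero, mul_zero]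
  rw [hitting_eq_resistance_mul_sum hc hirr hab hh, hitting_eq_resistance_mul_sum hc hirr hab.symm hh,
    effectiveResistance_comm hc hirr hab, unitVoltage_swap hc hirr hab, ← mul_add, ← sum_add_distrib,
    totalConductance_def, mul_comm]
  congr 1
  exact sum_congr rfl fun x _ => by ring

/-- **COROLLARY 10.8: the effective resistance satisfies the triangle inequality
`R(a ↔ c) ≤ R(a ↔ b) + R(b ↔ c)`** — "It is clear that `E_a τ_c ≤ E_a τ_b + E_b τ_c` … Switching the
roles of `a` and `c` shows that commute times satisfy a triangle inequality", then Prop. 10.7.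
[cite: LevinPeres2017, §10.3 Cor. 10.8, eq. (10.15)] -/
theorem LevinPeres2017_cor_10_8 (hc : IsConductance c) (hirr : IsIrreducible (networkKernel c))
    (a b d : X) :
    effectiveResistance c a d ≤ effectiveResistance c a b + effectiveResistance c b d := by
  haveI : Nonempty X := ⟨a⟩
  have hP := networkKernel_isRowStochastic hc
  obtain ⟨h, hh⟩ := exists_isHittingTimeSolution hP hirr
  have hcG := hc.totalConductance_pos
  have t1 := hh.triangle hP hirr a b d
  have t2 := hh.triangle hP hirr d b a
  have e1 := LevinPeres2017_prop_10_7 hc hirr hh a d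
  have e2 := LevinPeres2017_prop_10_7 hc hirr hh a b
  have e3 := LevinPeres2017_prop_10_7 hc hirr hh b d
  rw [commuteTime_def] at e1 e2 e3
  have key : totalConductance c * effectiveResistance c a d ≤
      totalConductance c * (effectiveResistance c a b + effectiveResistance c b d) := by
    rw [mul_add, ← e1, ← e2, ← e3]
    linarith
  exact le_of_mul_le_mul_left key hcG

/-- **Eq. (10.27) (transitive networks): `E_a(τ_b) = ½ c_G R(a ↔ b)`** — on a transitive connected
network `E_a(τ_b) = E_b(τ_a)` (Prop. 10.10), so each is half the commute time `c_G R(a ↔ b)`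
(Prop. 10.7); for the `d`-dimensional torus `c_G = 2dn^d`, giving the book's `E_a(τ_b) = dn^d R(a ↔ b)`.
[cite: LevinPeres2017, §10.6 eq. (10.27) with Prop. 10.7 and Prop. 10.10] -/
theorem LevinPeres2017_eq_10_27 (hc : IsConductance c) (hirr : IsIrreducible (networkKernel c))
    (hT : ∀ x y : X, ∃ ψ : X ≃ X, ψ x = y ∧ ∀ u v, c (ψ u) (ψ v) = c u v)
    (hh : IsHittingTimeSolution (networkKernel c) h) (a b : X) :
    h a b = totalConductance c / 2 * effectiveResistance c a b := by
  have h1 := LevinPeres2017_prop_10_7 hc hirr hh a b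
  have h2 := LevinPeres2017_prop_10_10 hc hirr hT hh a b
  rw [commuteTime_def, ← h2] at h1
  linarith

end CommuteTimeIdentity

end Literature.Probability.MarkovChains

namespace Literature.Probability.MarkovChains

open Finset Matrix SimpleGraph

variable {X : Type*} [Fintype X] [DecidableEq X]

/-- The UNIT FLOW ALONG ONE EDGE `{x, y}`: `+1` on `xy`, `−1` on `yx`, `0` elsewhere (the flow behind
"`R(a ↔ b) ≤ diam`": one unit of current through a single resistor). [cite: LevinPeres2017, §10.3,
proof of Prop. 10.16 ("Since `R(a ↔ b) ≤ diam`") with §9.4 Thm 9.10] -/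
def edgeFlow (x y : X) : X → X → ℝ :=
  fun u v => (if u = x ∧ v = y then 1 else 0) - (if u = y ∧ v = x then 1 else 0)

section EdgeBound

variable {c : Matrix X X ℝ}

omit [Fintype X] in
/-- `edgeFlow` unfolded. [cite: LevinPeres2017, §9.3 (flows on oriented edges)] -/
theorem edgeFlow_apply (x y u v : X) :
    edgeFlow x y u v = (if u = x ∧ v = y then 1 else 0) - (if u = y ∧ v = x then 1 else 0) := rfl

/-- For an edge `{x, y}` (`c(x,y) > 0`, `x ≠ y`) the edge flow is a unit flow from `x` to `y`.
[cite: LevinPeres2017, §9.3 eq. (9.6) (node law) and the definition of unit flow] -/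
theorem isUnitFlow_edgeFlow (hc : IsConductance c) {x y : X} (hxy : x ≠ y) (hcxy : 0 < c x y) :
    IsUnitFlow c x y (edgeFlow x y) := by
  refine ⟨⟨fun u v => ?_, fun u v h => ?_⟩, fun u hux huy => ?_, ?_⟩
  · rw [edgeFlow_apply, edgeFlow_apply]
    by_cases h1 : u = x ∧ v = y <;> by_cases h2 : u = y ∧ v = x <;> simp only [h1, h2, and_self,
      if_true, if_false, and_comm] <;> norm_num
  · rw [edgeFlow_apply]
    have h1 : ¬(u = x ∧ v = y) := fun ⟨hu, hv⟩ => hcxy.ne' (by rw [← hu, ← hv, h])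
    have h2 : ¬(u = y ∧ v = x) := fun ⟨hu, hv⟩ => by
      rw [hu, hv, hc.symm y x] at h
      exact hcxy.ne' h
    rw [if_neg h1, if_neg h2, sub_zero]
  · rw [flowDiv_def]
    exact sum_eq_zero fun v _ => by
      rw [edgeFlow_apply, if_neg (fun h => hux h.1), if_neg (fun h => huy h.1), sub_zero]
  · rw [flowDiv_def]
    have hterm : ∀ v, edgeFlow x y x v = if v = y then 1 else 0 := fun v => by
      rw [edgeFlow_apply, if_neg (show ¬(x = y ∧ v = x) from fun h => hxy h.1), sub_zero]
      by_cases hv : v = y <;> simp [hv]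
    rw [sum_congr rfl fun v _ => hterm v, sum_ite_eq' univ y, if_pos (mem_univ y)]

/-- Its energy is the resistance of the edge: `E = ½(r(xy) + r(yx)) = 1/c(x,y)`.
[cite: LevinPeres2017, §9.4 (definition of `E(θ)`)] -/
theorem flowEnergy_edgeFlow (hc : IsConductance c) {x y : X} (hxy : x ≠ y) :
    flowEnergy c (edgeFlow x y) = 1 / c x y := by
  rw [flowEnergy]
  have hterm : ∀ u v, edgeFlow x y u v ^ 2 / c u v =
      (if u = x ∧ v = y then 1 / c x y else 0) + (if u = y ∧ v = x then 1 / c x y else 0) := by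
    intro u v
    rw [edgeFlow_apply]
    by_cases h1 : u = x ∧ v = y
    · have h2 : ¬(u = y ∧ v = x) := fun h => hxy (h1.1.symm.trans h.1)
      rw [if_pos h1, if_neg h2, if_pos h1, if_neg h2, h1.1, h1.2]
      ring
    · by_cases h2 : u = y ∧ v = x
      · rw [if_neg h1, if_pos h2, if_neg h1, if_pos h2, h2.1, h2.2, hc.symm y x]
        ring
      · rw [if_neg h1, if_neg h2, if_neg h1, if_neg h2]
        simp
  simp_rw [hterm, sum_add_distrib]
  have hA : ∑ u, ∑ v, (if u = x ∧ v = y then 1 / c x y else (0 : ℝ)) = 1 / c x y := by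
    rw [Finset.sum_eq_single x, Finset.sum_eq_single y]
    · simp
    · intro v _ hv; rw [if_neg fun h => hv h.2]
    · intro h; exact absurd (mem_univ y) h
    · intro u _ hu; exact sum_eq_zero fun v _ => if_neg fun h => hu h.1
    · intro h; exact absurd (mem_univ x) h
  have hB : ∑ u, ∑ v, (if u = y ∧ v = x then 1 / c x y else (0 : ℝ)) = 1 / c x y := by
    rw [Finset.sum_eq_single y, Finset.sum_eq_single x]
    · simp
    · intro v _ hv; rw [if_neg fun h => hv h.2]
    · intro h; exact absurd (mem_univ x) h
    · intro u _ hu; exact sum_eq_zero fun v _ => if_neg fun h => hu h.1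
    · intro h; exact absurd (mem_univ y) h
  rw [hA, hB]
  ring

/-- **The effective resistance across an edge is at most the edge's resistance**:
`R(x ↔ y) ≤ r(x,y) = 1/c(x,y)` (Thomson's Principle applied to the unit flow along the edge; cf.
Cor. 9.13: the rest of the network can only lower the resistance). [cite: LevinPeres2017, §9.4
Thm 9.10 with Cor. 9.13; §10.3, proof of Prop. 10.16 ("Since `R(a ↔ b) ≤ diam`")] -/
theorem effectiveResistance_le_inv (hc : IsConductance c) (hirr : IsIrreducible (networkKernel c))
    {x y : X} (hcxy : 0 < c x y) : effectiveResistance c x y ≤ 1 / c x y := by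
  rcases eq_or_ne x y with rfl | hxy
  · rw [effectiveResistance_self]
    exact (one_div_pos.2 hcxy).le
  · rw [← flowEnergy_edgeFlow hc hxy]
    exact LevinPeres2017_thm_9_10 hc hirr hxy (isUnitFlow_edgeFlow hc hxy hcxy)

/-- **`R(a ↔ b) ≤ ρ · (length of any path of edges from a to b)`** when every edge used has
resistance `≤ ρ` — the triangle inequality (Cor. 10.8) along the path; with unit resistances this is
"`R(a ↔ b) ≤ diam`". Paths are Mathlib walks in a simple graph `G` whose edges are edges of the
network. [cite: LevinPeres2017, §10.3, proof of Prop. 10.16 ("Since `R(a ↔ b) ≤ diam`"); Cor. 10.8] -/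
theorem effectiveResistance_le_mul_length (hc : IsConductance c)
    (hirr : IsIrreducible (networkKernel c)) {G : SimpleGraph X} {ρ : ℝ}
    (hG : ∀ u v, G.Adj u v → 0 < c u v ∧ 1 / c u v ≤ ρ) :
    ∀ {a b : X} (p : G.Walk a b), effectiveResistance c a b ≤ ρ * p.length := by
  intro a b p
  induction p with
  | nil =>
    rw [Walk.length_nil, Nat.cast_zero, mul_zero, effectiveResistance_self]
  | @cons u v w huv p ih =>
    rw [Walk.length_cons, Nat.cast_succ, mul_add, mul_one]
    obtain ⟨hpos, hle⟩ := hG u v huv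
    calc effectiveResistance c u w ≤ effectiveResistance c u v + effectiveResistance c v w :=
          LevinPeres2017_cor_10_8 hc hirr u v w
      _ ≤ ρ + ρ * p.length := add_le_add ((effectiveResistance_le_inv hc hirr hpos).trans hle) ih
      _ = ρ * p.length + ρ := add_comm _ _

/-- **A BRIDGE has effective resistance equal to its own resistance**: if `{x, y}` is the only edge
of the network joining a node set `S ∋ x` to its complement `∋ y`, then `R(x ↔ y) = r(x,y) = 1/c(x,y)`
— `≤` by Thomson (the unit flow through the edge), `≥` by the Nash-Williams inequality (Prop. 9.16)
for the single cutset `∂S = {{x,y}}`.  This is the mechanism of Example 9.7 ("when `a` and `z` are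
two vertices in a tree … `R(a ↔ z)` is equal to the length of the unique path joining `a` and `z`":
every tree edge is a bridge). [cite: LevinPeres2017, §9.4 Example 9.7 with Prop. 9.16 and Thm 9.10] -/
theorem effectiveResistance_bridge (hc : IsConductance c) (hirr : IsIrreducible (networkKernel c))
    {x y : X} (hcxy : 0 < c x y) {S : Finset X} (hxS : x ∈ S) (hyS : y ∉ S)
    (hbridge : ∀ u ∈ S, ∀ v ∉ S, c u v ≠ 0 → u = x ∧ v = y) :
    effectiveResistance c x y = 1 / c x y := by
  have hxy : x ≠ y := fun h => hyS (h ▸ hxS)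
  refine le_antisymm (effectiveResistance_le_inv hc hirr hcxy) ?_
  -- Nash-Williams with the one cutset `S`: `1/cutConductance c S ≤ R(x ↔ y)`
  have hcut : cutConductance c S = c x y := by
    rw [cutConductance_def, ← Finset.sum_erase_add S _ hxS, Finset.sum_eq_zero, zero_add,
      ← Finset.sum_erase_add Sᶜ _ (Finset.mem_compl.2 hyS), Finset.sum_eq_zero, zero_add]
    · intro v hv
      have hv' : v ∉ S := Finset.mem_compl.1 (Finset.mem_of_mem_erase hv)
      by_contra h
      exact Finset.ne_of_mem_erase hv (hbridge x hxS v hv' h).2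
    · intro u hu
      refine Finset.sum_eq_zero fun v hv => ?_
      have hv' : v ∉ S := Finset.mem_compl.1 hv
      by_contra h
      exact Finset.ne_of_mem_erase hu (hbridge u (Finset.mem_of_mem_erase hu) v hv' h).1
  have h916 := LevinPeres2017_prop_9_16 hc hirr hxy (Finset.univ : Finset Unit) (fun _ => S)
    (fun _ _ => hxS) (fun _ _ => hyS) (fun j _ k _ hjk => absurd (Subsingleton.elim j k) hjk)
  rw [Finset.sum_const, Finset.card_univ, Fintype.card_unit, one_smul, hcut] at h916
  exact h916

end EdgeBound

/-! ## Proposition 10.16 (a): `t_{a↔b} ≤ 2nm ≤ n³` for simple random walk on a simple graph -/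

section SimpleGraph

variable {V : Type*} [Fintype V] [DecidableEq V] {G : SimpleGraph V} [DecidableRel G.Adj]

omit [DecidableEq V] in
/-- `c_G = Σ_x deg(x) = 2|E|` for unit conductances ("`c_G = 2 Σ_e c(e)`" without loops).
[cite: LevinPeres2017, §9.1 ("In the case that the graph has no loops, we have `c_G = 2Σ_{e∈E} c(e)`")
and §10.3 Prop. 10.7 (recall of `c_G`)] -/
theorem totalConductance_adjMatrix :
    totalConductance (G.adjMatrix ℝ) = 2 * (#G.edgeFinset : ℝ) := by
  rw [totalConductance_def]
  simp_rw [nodeConductance_adjMatrix]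
  exact_mod_cast G.sum_degrees_eq_twice_card_edges

omit [DecidableEq V] in
/-- A connected simple graph on at least two vertices has no isolated vertex. [cite: LevinPeres2017,
§1.4 (simple random walk is defined when every vertex has a neighbour)] -/
theorem degree_pos_of_connected [Nontrivial V] (hconn : G.Connected) (x : V) : 0 < G.degree x := by
  obtain ⟨y, hy⟩ := exists_ne x
  obtain ⟨p⟩ := hconn.preconnected x y
  cases p with
  | nil => exact absurd rfl hy
  | cons h _ => exact (G.degree_pos_iff_exists_adj x).2 ⟨_, h⟩

/-- For simple random walk on a connected simple graph: **`R(a ↔ b) ≤ dist(a,b) ≤ n − 1`** (unit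
resistances; a shortest path is a path, of length `< n`). [cite: LevinPeres2017, §10.3, proof of
Prop. 10.16 ("Since `R(a ↔ b) ≤ diam`")] -/
theorem effectiveResistance_adjMatrix_le [Nontrivial V] (hconn : G.Connected) (a b : V) :
    effectiveResistance (G.adjMatrix ℝ) a b ≤ (Fintype.card V : ℝ) - 1 := by
  have hc := isConductance_adjMatrix (degree_pos_of_connected hconn)
  have hirr : IsIrreducible (networkKernel (G.adjMatrix ℝ)) := by
    rw [networkKernel_adjMatrix]
    exact srwKernel_isIrreducible_iff.2 hconn.preconnected
  obtain ⟨p⟩ := hconn.preconnected a b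
  have hG : ∀ u v, G.Adj u v → 0 < G.adjMatrix ℝ u v ∧ 1 / G.adjMatrix ℝ u v ≤ (1 : ℝ) := by
    intro u v huv
    rw [adjMatrix_apply, if_pos huv]
    norm_num
  have h1 := effectiveResistance_le_mul_length hc hirr hG p.bypass
  have h2 : (p.bypass.length : ℝ) ≤ (Fintype.card V : ℝ) - 1 := by
    have := p.bypass_isPath.length_lt
    have h3 : (p.bypass.length : ℝ) + 1 ≤ Fintype.card V := by exact_mod_cast this
    linarith
  linarith

/-- **PROPOSITION 10.16 (a): for random walk on a (connected) simple graph with `n` vertices and `m`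
edges, `t_{a↔b} ≤ 2nm` for all `a, b`** — `t_{a↔b} = R(a ↔ b) · 2m` (Prop. 10.7) and `R(a ↔ b) ≤
diam ≤ n − 1`. [cite: LevinPeres2017, §10.3 Prop. 10.16 (a)] -/
theorem LevinPeres2017_prop_10_16_a [Nontrivial V] (hconn : G.Connected) {h : V → V → ℝ}
    (hh : IsHittingTimeSolution (srwKernel G) h) (a b : V) :
    commuteTime h a b ≤ 2 * (Fintype.card V : ℝ) * #G.edgeFinset := by
  have hc := isConductance_adjMatrix (degree_pos_of_connected hconn)
  have hirr : IsIrreducible (networkKernel (G.adjMatrix ℝ)) := by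
    rw [networkKernel_adjMatrix]
    exact srwKernel_isIrreducible_iff.2 hconn.preconnected
  have hh' : IsHittingTimeSolution (networkKernel (G.adjMatrix ℝ)) h := by
    rw [networkKernel_adjMatrix]; exact hh
  rw [LevinPeres2017_prop_10_7 hc hirr hh' a b, totalConductance_adjMatrix]
  have hR := effectiveResistance_adjMatrix_le hconn a b
  have hm : (0 : ℝ) ≤ #G.edgeFinset := Nat.cast_nonneg _
  nlinarith

/-- **PROPOSITION 10.16 (a), second inequality: `t_{a↔b} ≤ 2nm ≤ n³`** (`2m ≤ n(n−1) ≤ n²` for a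
simple graph). [cite: LevinPeres2017, §10.3 Prop. 10.16 (a)] -/
theorem LevinPeres2017_prop_10_16_a' [Nontrivial V] (hconn : G.Connected) {h : V → V → ℝ}
    (hh : IsHittingTimeSolution (srwKernel G) h) (a b : V) :
    commuteTime h a b ≤ (Fintype.card V : ℝ) ^ 3 := by
  have h1 := LevinPeres2017_prop_10_16_a hconn hh a b
  have h2 : (#G.edgeFinset : ℝ) ≤ (Fintype.card V : ℝ) * ((Fintype.card V : ℝ) - 1) / 2 := by
    have h3 : (#G.edgeFinset : ℝ) ≤ ((Fintype.card V).choose 2 : ℕ) := by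
      exact_mod_cast G.card_edgeFinset_le_card_choose_two
    rw [Nat.cast_choose_two] at h3
    exact h3
  have hn : (1 : ℝ) ≤ Fintype.card V := by exact_mod_cast Fintype.card_pos
  nlinarith

end SimpleGraph

end Literature.Probability.MarkovChains
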